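import Mathlib
import Literature.Analysis.Calculus.SmoothCutoff
import HarnessLib

/-!
# Leray capping, tools II: vertical cut-off profiles and horizontal cell integrals

Tools file for `stub_lerayCapping` of
`Summit.AnomalousDissipation.AnomalousDissipation.Theses.DyadicWallCascade.DyadicRealisation`
(line Sketch):

* `lerayCapping_profiles` — the two smooth one-sided vertical cut-offs `θ` (`= 1` on `t ≤ 5/64`,
  `= 0` on `t ≥ 7/64`) and `χ` (`= 1` on `t ≤ 1/8`, `= 0` on `t ≥ 3/16`), built from
  `Real.smoothTransition`;
* `lerayCapping_cell_integral_scale_one` / `_two` — `∫_{[0,1]} k(N y) dy = ∫_{[0,1]} k` and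
  `∫_{[0,1]²} h(N q) dq = ∫_{[0,1]²} h` for continuous `1`-periodic integrands and `N ∈ ℕ₊`;
* `lerayCapping_slice_dyadic` — for a dilation-invariant function on the upper half-space,
  `1`-periodic on the band `1 ≤ X₂ ≤ 2`, the horizontal cell integral at height `2⁻ⁿ` equals the
  one at height `1`.

The file ends with the registered tools stub `stub_lerayCappingTools2`.
-/

open Set Function MeasureTheory intervalIntegral
open scoped BigOperators

set_option linter.dupNamespace false

namespace Summit.AnomalousDissipation.AnomalousDissipation.Theorems

/-- A rescaled smooth transition `t ↦ S (a - b t)`: smooth, valued in `[0, 1]`, `= 1` where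
`a - b t ≥ 1`, `= 0` where `a - b t ≤ 0`, with vanishing derivative on both plateaux. [folklore] -/
theorem lerayCapping_profile_affine (a b : ℝ) :
    ContDiff ℝ ((⊤ : ℕ∞) : WithTop ℕ∞) (fun t : ℝ => Real.smoothTransition (a - b * t)) ∧
    (∀ t : ℝ, 0 ≤ Real.smoothTransition (a - b * t) ∧ Real.smoothTransition (a - b * t) ≤ 1) ∧
    (∀ t : ℝ, 1 ≤ a - b * t → Real.smoothTransition (a - b * t) = 1) ∧
    (∀ t : ℝ, a - b * t ≤ 0 → Real.smoothTransition (a - b * t) = 0) ∧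
    (∀ t : ℝ, (1 ≤ a - b * t ∨ a - b * t ≤ 0) →
      deriv (fun t : ℝ => Real.smoothTransition (a - b * t)) t = 0) := by
  have hS : ContDiff ℝ ((⊤ : ℕ∞) : WithTop ℕ∞) Real.smoothTransition := Real.smoothTransition.contDiff
  have hA : ContDiff ℝ ((⊤ : ℕ∞) : WithTop ℕ∞) (fun t : ℝ => a - b * t) :=
    contDiff_const.sub (contDiff_const.mul contDiff_id)
  refine ⟨hS.comp hA, fun t => ⟨Real.smoothTransition.nonneg _, Real.smoothTransition.le_one _⟩,
    fun t ht => Real.smoothTransition.one_of_one_le ht,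
    fun t ht => Real.smoothTransition.zero_of_nonpos ht, fun t ht => ?_⟩
  have hAd : HasDerivAt (fun t : ℝ => a - b * t) (-b) t := by
    simpa using ((hasDerivAt_id t).const_mul b).const_sub a
  have hSd : HasDerivAt Real.smoothTransition (deriv Real.smoothTransition (a - b * t)) (a - b * t) :=
    (Literature.Analysis.Calculus.differentiable_smoothTransition _).hasDerivAt
  have hc := hSd.comp t hAd
  rw [show (fun t : ℝ => Real.smoothTransition (a - b * t)) =
      Real.smoothTransition ∘ (fun t : ℝ => a - b * t) from rfl, hc.deriv]
  rcases ht with ht | ht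
  · rw [Literature.Analysis.Calculus.deriv_smoothTransition_of_one_le ht, zero_mul]
  · rw [Literature.Analysis.Calculus.deriv_smoothTransition_of_nonpos ht, zero_mul]

/-- **The vertical cut-off profiles.** Smooth `θ, χ : ℝ → [0, 1]` with `θ = 1` on `t ≤ 5/64`,
`θ = 0` on `t ≥ 7/64`, `χ = 1` on `t ≤ 1/8`, `χ = 0` on `t ≥ 3/16`, and `θ' = 0`, `χ' = 0` on the
respective plateaux. [folklore] -/
theorem lerayCapping_profiles :
    ∃ θ χ : ℝ → ℝ,
      ContDiff ℝ ((⊤ : ℕ∞) : WithTop ℕ∞) θ ∧ ContDiff ℝ ((⊤ : ℕ∞) : WithTop ℕ∞) χ ∧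
      (∀ t : ℝ, 0 ≤ θ t ∧ θ t ≤ 1) ∧ (∀ t : ℝ, 0 ≤ χ t ∧ χ t ≤ 1) ∧
      (∀ t : ℝ, t ≤ 5 / 64 → θ t = 1) ∧ (∀ t : ℝ, 7 / 64 ≤ t → θ t = 0) ∧
      (∀ t : ℝ, (t ≤ 5 / 64 ∨ 7 / 64 ≤ t) → deriv θ t = 0) ∧
      (∀ t : ℝ, t ≤ 1 / 8 → χ t = 1) ∧ (∀ t : ℝ, 3 / 16 ≤ t → χ t = 0) ∧
      (∀ t : ℝ, (t ≤ 1 / 8 ∨ 3 / 16 ≤ t) → deriv χ t = 0) := by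
  obtain ⟨h1, h2, h3, h4, h5⟩ := lerayCapping_profile_affine (7 / 2) 32
  obtain ⟨g1, g2, g3, g4, g5⟩ := lerayCapping_profile_affine 3 16
  refine ⟨fun t => Real.smoothTransition (7 / 2 - 32 * t), fun t => Real.smoothTransition (3 - 16 * t),
    h1, g1, h2, g2, fun t ht => h3 t (by linarith), fun t ht => h4 t (by linarith),
    fun t ht => h5 t ?_, fun t ht => g3 t (by linarith), fun t ht => g4 t (by linarith),
    fun t ht => g5 t ?_⟩
  · rcases ht with ht | ht
    · left; linarith
    · right; linarith
  · rcases ht with ht | ht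
    · left; linarith
    · right; linarith

/-- **Cell integrals are invariant under integer dilation, one variable**: for a continuous
`1`-periodic `k` and `N ∈ ℕ₊`, `∫_{[0,1]} k(N y) dy = ∫_{[0,1]} k`. [folklore] -/
theorem lerayCapping_cell_integral_scale_one (k : ℝ → ℝ) (N : ℕ) (hN : 0 < N) (hk : Continuous k)
    (hper : Function.Periodic k 1) :
    ∫ y in Icc (0 : ℝ) 1, k ((N : ℝ) * y) = ∫ y in Icc (0 : ℝ) 1, k y := by
  have hN' : (N : ℝ) ≠ 0 := by exact_mod_cast hN.ne'
  rw [integral_Icc_eq_integral_Ioc, ← intervalIntegral.integral_of_le zero_le_one,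
    integral_Icc_eq_integral_Ioc, ← intervalIntegral.integral_of_le zero_le_one,
    intervalIntegral.integral_comp_mul_left k hN', mul_zero, mul_one]
  have hz := hper.intervalIntegral_add_zsmul_eq (N : ℤ) 0 (fun t₁ t₂ => hk.intervalIntegrable t₁ t₂)
  simp only [zero_add, zsmul_eq_mul, Int.cast_natCast, mul_one] at hz
  rw [hz, smul_eq_mul, ← mul_assoc, inv_mul_cancel₀ hN', one_mul]

/-- **Cell integrals are invariant under integer dilation, two variables**: for a continuous
`h : ℝ² → ℝ`, `1`-periodic in both variables, and `N ∈ ℕ₊`, `∫_{[0,1]²} h(N q) dq = ∫_{[0,1]²} h`.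
[folklore] -/
theorem lerayCapping_cell_integral_scale_two (h : ℝ × ℝ → ℝ) (N : ℕ) (hN : 0 < N)
    (hh : Continuous h) (hper1 : ∀ a b : ℝ, h (a + 1, b) = h (a, b))
    (hper2 : ∀ a b : ℝ, h (a, b + 1) = h (a, b)) :
    ∫ q in Icc (0 : ℝ) 1 ×ˢ Icc (0 : ℝ) 1, h ((N : ℝ) * q.1, (N : ℝ) * q.2) =
      ∫ q in Icc (0 : ℝ) 1 ×ˢ Icc (0 : ℝ) 1, h q := by
  have hI : ∀ g : ℝ × ℝ → ℝ, Continuous g →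
      IntegrableOn g (Icc (0 : ℝ) 1 ×ˢ Icc (0 : ℝ) 1) (volume.prod volume) := fun g hg =>
    hg.continuousOn.integrableOn_compact (isCompact_Icc.prod isCompact_Icc)
  have hcN : Continuous fun q : ℝ × ℝ => h ((N : ℝ) * q.1, (N : ℝ) * q.2) :=
    hh.comp ((continuous_const.mul continuous_fst).prodMk (continuous_const.mul continuous_snd))
  rw [Measure.volume_eq_prod, setIntegral_prod _ (hI _ hcN), setIntegral_prod _ (hI _ hh)]
  -- the inner integrals
  have hinner : ∀ x : ℝ, ∫ y in Icc (0 : ℝ) 1, h ((N : ℝ) * x, (N : ℝ) * y) =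
      ∫ y in Icc (0 : ℝ) 1, h ((N : ℝ) * x, y) := fun x =>
    lerayCapping_cell_integral_scale_one (fun y => h ((N : ℝ) * x, y)) N hN
      (hh.comp (continuous_const.prodMk continuous_id)) (fun y => hper2 _ _)
  simp only
  simp_rw [hinner]
  -- the outer integral
  set H : ℝ → ℝ := fun a => ∫ y in Icc (0 : ℝ) 1, h (a, y) with hH
  have hHc : Continuous H := by
    have : H = fun a => ∫ y in (0 : ℝ)..1, h (a, y) := by
      funext a
      simp only [hH, intervalIntegral.integral_of_le zero_le_one, integral_Icc_eq_integral_Ioc]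
    rw [this]
    exact intervalIntegral.continuous_parametric_intervalIntegral_of_continuous'
      (f := fun a y => h (a, y)) (by exact hh.comp (continuous_fst.prodMk continuous_snd)) 0 1
  have hHp : Function.Periodic H 1 := fun a => by
    simp only [hH]
    exact setIntegral_congr_fun measurableSet_Icc fun y _ => hper1 a y
  exact lerayCapping_cell_integral_scale_one H N hN hHc hHp

/-- **Dyadic invariance of horizontal cell integrals.** For `Φ` continuous on the upper
half-space, dilation invariant (`Φ (2X) = Φ X`) and `1`-periodic in `X₀, X₁` on the band
`1 ≤ X₂ ≤ 2`, the cell integral at height `2⁻ⁿ` equals the one at height `1`. [folklore] -/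
theorem lerayCapping_slice_dyadic (Φ : EuclideanSpace ℝ (Fin 3) → ℝ)
    (hΦc : ContinuousOn Φ {X : EuclideanSpace ℝ (Fin 3) | 0 < X 2})
    (hdil : ∀ X : EuclideanSpace ℝ (Fin 3), 0 < X 2 → Φ ((2 : ℝ) • X) = Φ X)
    (hper : ∀ X : EuclideanSpace ℝ (Fin 3), 1 ≤ X 2 → X 2 ≤ 2 →
      Φ (X + EuclideanSpace.single 0 (1 : ℝ)) = Φ X ∧ Φ (X + EuclideanSpace.single 1 (1 : ℝ)) = Φ X)
    (n : ℕ) :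
    ∫ q in Icc (0 : ℝ) 1 ×ˢ Icc (0 : ℝ) 1, Φ !₂[q.1, q.2, ((2 : ℝ) ^ n)⁻¹] =
      ∫ q in Icc (0 : ℝ) 1 ×ˢ Icc (0 : ℝ) 1, Φ !₂[q.1, q.2, (1 : ℝ)] := by
  -- iterate the dilation
  have hiter : ∀ (m : ℕ) (X : EuclideanSpace ℝ (Fin 3)), 0 < X 2 → Φ ((2 : ℝ) ^ m • X) = Φ X := by
    intro m
    induction m with
    | zero => intro X _; simp
    | succ m ih =>
      intro X hX
      have hpos : 0 < ((2 : ℝ) ^ m • X) 2 := by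
        rw [PiLp.smul_apply, smul_eq_mul]; positivity
      have h := hdil ((2 : ℝ) ^ m • X) hpos
      rw [smul_smul, ← pow_succ'] at h
      exact h.trans (ih X hX)
  have hpt : ∀ q : ℝ × ℝ, Φ !₂[q.1, q.2, ((2 : ℝ) ^ n)⁻¹] =
      Φ !₂[(2 : ℝ) ^ n * q.1, (2 : ℝ) ^ n * q.2, (1 : ℝ)] := by
    intro q
    have hpos : 0 < (!₂[q.1, q.2, ((2 : ℝ) ^ n)⁻¹] : EuclideanSpace ℝ (Fin 3)) 2 := by
      simp
    rw [← hiter n _ hpos]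
    congr 1
    ext i
    fin_cases i <;> simp
  simp_rw [hpt]
  -- the trace at height one
  set h : ℝ × ℝ → ℝ := fun q => Φ !₂[q.1, q.2, (1 : ℝ)] with hh
  have hemb : Continuous fun q : ℝ × ℝ => (!₂[q.1, q.2, (1 : ℝ)] : EuclideanSpace ℝ (Fin 3)) := by
    refine (PiLp.continuous_toLp 2 _).comp ?_
    refine continuous_pi fun i => ?_
    fin_cases i
    · simpa using continuous_fst
    · simpa using continuous_snd
    · simpa using continuous_const
  have hhc : Continuous h := by
    refine hΦc.comp_continuous hemb fun q => ?_
    simp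
  have hp1 : ∀ a b : ℝ, h (a + 1, b) = h (a, b) := by
    intro a b
    simp only [hh]
    have := (hper !₂[a, b, (1 : ℝ)] (by simp) (by simp; try norm_num)).1
    rw [← this]
    congr 1
    ext i; fin_cases i <;> simp
  have hp2 : ∀ a b : ℝ, h (a, b + 1) = h (a, b) := by
    intro a b
    simp only [hh]
    have := (hper !₂[a, b, (1 : ℝ)] (by simp) (by simp; try norm_num)).2
    rw [← this]
    congr 1
    ext i; fin_cases i <;> simp
  have hN : 0 < 2 ^ n := pow_pos two_pos n
  have key := lerayCapping_cell_integral_scale_two h (2 ^ n) hN hhc hp1 hp2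
  push_cast at key
  exact key

/-- Registered tools stub of `stub_lerayCapping` (line Sketch of crux `DyadicRealisation`): the
conjunction of the lemmas of this file. [folklore] -/
theorem stub_lerayCappingTools2 :
    (∀ a b : ℝ,
      ContDiff ℝ ((⊤ : ℕ∞) : WithTop ℕ∞) (fun t : ℝ => Real.smoothTransition (a - b * t)) ∧
      (∀ t : ℝ, 0 ≤ Real.smoothTransition (a - b * t) ∧ Real.smoothTransition (a - b * t) ≤ 1) ∧
      (∀ t : ℝ, 1 ≤ a - b * t → Real.smoothTransition (a - b * t) = 1) ∧
      (∀ t : ℝ, a - b * t ≤ 0 → Real.smoothTransition (a - b * t) = 0) ∧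
      (∀ t : ℝ, (1 ≤ a - b * t ∨ a - b * t ≤ 0) →
        deriv (fun t : ℝ => Real.smoothTransition (a - b * t)) t = 0)) ∧
    (∃ θ χ : ℝ → ℝ,
      ContDiff ℝ ((⊤ : ℕ∞) : WithTop ℕ∞) θ ∧ ContDiff ℝ ((⊤ : ℕ∞) : WithTop ℕ∞) χ ∧
      (∀ t : ℝ, 0 ≤ θ t ∧ θ t ≤ 1) ∧ (∀ t : ℝ, 0 ≤ χ t ∧ χ t ≤ 1) ∧
      (∀ t : ℝ, t ≤ 5 / 64 → θ t = 1) ∧ (∀ t : ℝ, 7 / 64 ≤ t → θ t = 0) ∧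
      (∀ t : ℝ, (t ≤ 5 / 64 ∨ 7 / 64 ≤ t) → deriv θ t = 0) ∧
      (∀ t : ℝ, t ≤ 1 / 8 → χ t = 1) ∧ (∀ t : ℝ, 3 / 16 ≤ t → χ t = 0) ∧
      (∀ t : ℝ, (t ≤ 1 / 8 ∨ 3 / 16 ≤ t) → deriv χ t = 0)) ∧
    (∀ (k : ℝ → ℝ) (N : ℕ), 0 < N → Continuous k → Function.Periodic k 1 →
      ∫ y in Set.Icc (0 : ℝ) 1, k ((N : ℝ) * y) = ∫ y in Set.Icc (0 : ℝ) 1, k y) ∧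
    (∀ (h : ℝ × ℝ → ℝ) (N : ℕ), 0 < N → Continuous h → (∀ a b : ℝ, h (a + 1, b) = h (a, b)) →
      (∀ a b : ℝ, h (a, b + 1) = h (a, b)) →
      ∫ q in Set.Icc (0 : ℝ) 1 ×ˢ Set.Icc (0 : ℝ) 1, h ((N : ℝ) * q.1, (N : ℝ) * q.2) =
        ∫ q in Set.Icc (0 : ℝ) 1 ×ˢ Set.Icc (0 : ℝ) 1, h q) ∧
    (∀ (Φ : EuclideanSpace ℝ (Fin 3) → ℝ), ContinuousOn Φ {X : EuclideanSpace ℝ (Fin 3) | 0 < X 2} →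
      (∀ X : EuclideanSpace ℝ (Fin 3), 0 < X 2 → Φ ((2 : ℝ) • X) = Φ X) →
      (∀ X : EuclideanSpace ℝ (Fin 3), 1 ≤ X 2 → X 2 ≤ 2 →
        Φ (X + EuclideanSpace.single 0 (1 : ℝ)) = Φ X ∧ Φ (X + EuclideanSpace.single 1 (1 : ℝ)) = Φ X) →
      ∀ n : ℕ, ∫ q in Set.Icc (0 : ℝ) 1 ×ˢ Set.Icc (0 : ℝ) 1, Φ !₂[q.1, q.2, ((2 : ℝ) ^ n)⁻¹] =
        ∫ q in Set.Icc (0 : ℝ) 1 ×ˢ Set.Icc (0 : ℝ) 1, Φ !₂[q.1, q.2, (1 : ℝ)]) :=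
  ⟨lerayCapping_profile_affine, lerayCapping_profiles, lerayCapping_cell_integral_scale_one,
    lerayCapping_cell_integral_scale_two, lerayCapping_slice_dyadic⟩

end Summit.AnomalousDissipation.AnomalousDissipation.Theorems
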